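import Literature.MathematicalPhysics.QuantumFieldTheory.Balaban1983to89.Beta.OneStepKernelFamily
import Literature.MathematicalPhysics.QuantumFieldTheory.Balaban1983to89.Beta.ScalewiseWitness

/-!
# `BalabanUV.Beta.OneShotJ1Split` — row D1 ∕ (C1): **THE (J1-COMP) SPLIT** — road «BF-x»'s one-loop row `hC₁` at a COMPOSITE one-shot family follows
# from the same row at a ONE-SHOT-TABLE family plus the (J1-COMP) bound between the two one-shot kernels (F6D SPEC FINAL §4, typed)

WHY (located).  F6D SPEC FINAL §4 (row D1 OWNER an2 g54; booked on the OWNER d1-p2 g26's W-g26-1 (a)): road «BF-x»'s END `RoadEndBFxHybS.d1Rep_BFx_hyb_sbpS`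
takes a composite jet family `Jc` with ONE open row `hC₁ : ∀ m ≥ 1, |secondMoment (fun c e z => TshotOf Lc Jc m c e z − K_m c e z) μ ν| ≤ CJ1`, `K_m` the road's pin at
blocking `Lc^m`.  The road prices that row for the one-shot-TABLE family `Jt := JcOfTabs …` (its identity layer is table-specific); at the pair of record
`Jc := JcComp …` (F6d-2) one has `Jc 1 = Jt 1` and, for `m ≥ 2`, the triangle inequality `hC₁[Jc] ≤ hC₁[Jt] + (J1-COMP)_m` with
(J1-COMP) `:= |secondMoment (TshotOf Lc Jc m − TshotOf Lc Jt m) μ ν| ≤ CJ1′`.  This file is that sentence as a theorem, for ANY two composite jet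
families agreeing at depth `1` and ANY road kernels with absolutely summable second moments — so it serves the hybrid road, a RE-TABLED road
(R-D1-g55-1: `K_m` over the comb record) and the pair of record alike.

WHAT ([folklore]; no definition; Literature `ScalewiseWitness` ∕ `OneStepKernelFamily` BY NAME):
* §1 `absMoment₂_sub`, `secondMoment_sub` (the (1.22) second moment is subtractive over kernels with absolutely summable second moments),
  **`abs_secondMoment_sub_le_split`**: `|S2(T − K)| ≤ |S2(T − O)| + |S2(O − K)|` for `T O K : EKer 4` with `AbsMoment₂` entries.
* §2 **`hC1_of_tabs_and_comp`**: for `Jc Jt : ∀ m, JetData 3 (Lc^m)` with `TshotOf Lc Jc 1 = TshotOf Lc Jt 1`, road kernels `K : ℕ → EKer 4` with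
  `AbsMoment₂` entries for `m ≥ 1`, the row at `Jt` with constant `CJ1` and the (J1-COMP) bound with constant `CJ1′ ≥ 0` for `m ≥ 2` give the row at
  `Jc` with constant `CJ1 + CJ1′`, in the END's literal lambda shape.
WHAT THIS IS NOT: not a bound on anything ((J1-COMP) and `hC₁[Jt]` stay DISPLAYED); not the instance at `(JcComp, JcOfTabs)` (one line once F6d-2 is in the
tree: `TshotOf_JcComp_one` + `TshotOf_JcOfTabs_one`); nothing of Bałaban's asserted, valued or discharged; 0 estimates; 0∕4 row-D1 binders; NOT (C1) complete,
NOT D1, NEVER «G-an2-4 closed», NOT BetaPertH, NOT continuum, NOT Clay.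

HONEST DEPENDENCY (page 1, mandatory): continuum YM on T⁴ ⇐ BetaPertH ∧ nine spine estimates (0/9 proved); BetaPertH ⇐ (D1) ∧ (D4) ∧ CAP+tail;
G-an2-4 gates asym, D1 and NE2/3/4.  Row D1 ∕ (C1) OWNER an2, gen 55, 2026-08-24.  No existing file touched.
-/

noncomputable section

namespace Summit.QuantumFields.BalabanUV.Beta.OneShotJ1Split

open Literature.MathematicalPhysics.QuantumFieldTheory.Balaban1983to89
open Literature.MathematicalPhysics.QuantumFieldTheory.Balaban1983to89.Beta
open B12Beta (secondMoment)
open DressedMomentNormalisation (EKer)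
open DecimatedMomentSummable (AbsMoment₂)
open ScalewiseWitness (secondMoment_add absMoment₂_add absMoment₂_const_mul summable_secondMoment_term)
open OneStepResolventKernel (JetData)
open OneStepKernelFamily (TshotOf absMoment₂_TshotOf)

/-! ## §1 Second moments of differences -/

/-- [folklore] `AbsMoment₂` is closed under subtraction (as `ScalewiseWitness.absMoment₂_add`, with `|f − g| ≤ |f| + |g|`). -/
theorem absMoment₂_sub {f g : (Fin 4 → ℤ) → ℝ} (hf : AbsMoment₂ f) (hg : AbsMoment₂ g) : AbsMoment₂ (f - g) := by
  unfold AbsMoment₂ at hf hg ⊢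
  refine (hf.add hg).of_nonneg_of_le (fun z => by positivity) fun z => ?_
  rw [Pi.sub_apply, ← mul_add]
  exact mul_le_mul_of_nonneg_left (abs_sub _ _) (by positivity)

/-- [folklore] the (1.22) second moment is SUBTRACTIVE over kernels with absolutely summable second moments (`Summable.tsum_sub`). -/
theorem secondMoment_sub {P Q : EKer 4} (hP : ∀ c e, AbsMoment₂ (P c e)) (hQ : ∀ c e, AbsMoment₂ (Q c e)) (μ ν : Fin 4) :
    secondMoment (P - Q) μ ν = secondMoment P μ ν - secondMoment Q μ ν := by
  unfold secondMoment
  rw [← (summable_secondMoment_term (hP μ ν) μ ν).tsum_sub (summable_secondMoment_term (hQ μ ν) μ ν)]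
  refine tsum_congr fun x => ?_
  simp only [Pi.sub_apply]
  ring

/-- [folklore] **THE SPLIT**: `|S2(T − K)| ≤ |S2(T − O)| + |S2(O − K)|` for kernels with absolutely summable second moments. -/
theorem abs_secondMoment_sub_le_split {T O K : EKer 4} (hT : ∀ c e, AbsMoment₂ (T c e)) (hO : ∀ c e, AbsMoment₂ (O c e))
    (hK : ∀ c e, AbsMoment₂ (K c e)) (μ ν : Fin 4) :
    |secondMoment (T - K) μ ν| ≤ |secondMoment (T - O) μ ν| + |secondMoment (O - K) μ ν| := by
  have e : T - K = (T - O) + (O - K) := (sub_add_sub_cancel T O K).symm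
  rw [e, secondMoment_add (P := T - O) (Q := O - K) (fun c e => absMoment₂_sub (hT c e) (hO c e)) (fun c e => absMoment₂_sub (hO c e) (hK c e))]
  exact abs_add_le _ _

/-! ## §2 The row `hC₁` at a composite family from the row at a one-shot-table family and (J1-COMP) -/

/-- [folklore] **`hC₁[Jc] ≤ hC₁[Jt] + (J1-COMP)`** in road «BF-x»'s literal lambda shape: two composite jet families `Jc, Jt` agreeing at depth `1`, road kernels
`K m` with absolutely summable second moments, the one-loop row at `Jt` (constant `CJ1`) and the (J1-COMP) bound between the one-shot kernels for `m ≥ 2`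
(constant `CJ1′ ≥ 0`) give the one-loop row at `Jc` with constant `CJ1 + CJ1′`. -/
theorem hC1_of_tabs_and_comp {Lc : ℕ} [NeZero Lc] (Jc Jt : ∀ m : ℕ, JetData 3 (Lc ^ m)) (K : ℕ → EKer 4) {μ ν : Fin 4} {CJ1 CJ1' : ℝ}
    (hone : TshotOf Lc Jc 1 = TshotOf Lc Jt 1) (hK : ∀ m : ℕ, 1 ≤ m → ∀ c e, AbsMoment₂ (K m c e)) (hCJ1' : 0 ≤ CJ1')
    (htabs : ∀ m : ℕ, 1 ≤ m → |secondMoment (fun (c e : Fin 4) (z : Fin 4 → ℤ) => TshotOf Lc Jt m c e z - K m c e z) μ ν| ≤ CJ1)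
    (hcomp : ∀ m : ℕ, 2 ≤ m →
      |secondMoment (fun (c e : Fin 4) (z : Fin 4 → ℤ) => TshotOf Lc Jc m c e z - TshotOf Lc Jt m c e z) μ ν| ≤ CJ1') :
    ∀ m : ℕ, 1 ≤ m → |secondMoment (fun (c e : Fin 4) (z : Fin 4 → ℤ) => TshotOf Lc Jc m c e z - K m c e z) μ ν| ≤ CJ1 + CJ1' := by
  intro m hm
  rcases Nat.lt_or_ge m 2 with h | h
  · obtain rfl : m = 1 := by omega
    rw [hone]
    exact (htabs 1 le_rfl).trans (le_add_of_nonneg_right hCJ1')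
  · have hs := abs_secondMoment_sub_le_split (T := TshotOf Lc Jc m) (O := TshotOf Lc Jt m) (K := K m)
      (absMoment₂_TshotOf Jc m) (absMoment₂_TshotOf Jt m) (hK m hm) μ ν
    calc |secondMoment (fun (c e : Fin 4) (z : Fin 4 → ℤ) => TshotOf Lc Jc m c e z - K m c e z) μ ν|
        = |secondMoment (TshotOf Lc Jc m - K m) μ ν| := rfl
      _ ≤ |secondMoment (TshotOf Lc Jc m - TshotOf Lc Jt m) μ ν| + |secondMoment (TshotOf Lc Jt m - K m) μ ν| := hs
      _ ≤ CJ1' + CJ1 := add_le_add (hcomp m h) (htabs m hm)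
      _ = CJ1 + CJ1' := add_comm _ _

end Summit.QuantumFields.BalabanUV.Beta.OneShotJ1Split

end
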